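/-
Copyright: cell pub-balaban-gaps (YM BLITZ Y1, track G1), seat g1-p2 GEN 7 (unit `pub-balaban-gaps-g1-p2`).  Row (D4) NODE O,
OBJECT level — CAPSTONE of the one-scale covariant chain 55–65: the block random-walk expansion with derivative letters of the one-scale
COVARIANT PROPAGATOR `(Δ_U + m² + a_KQ_K(U)*Q_K(U))⁻¹` of a LATTICE GAUGE FIELD given by its bond logarithms `X_μ(u, x)` (`U_b = e^{X_b}`,
`X = iηA(b)` in print) under the two (3.37)-SHAPED WINDOWS ON `X` and an in-cube CONTOUR SYSTEM `Γ` (lengths `≤ N`, `Nη ≤ ℓ`): bond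
transporters `e^{±X}` (61a), their defects and the two defect windows (60a), contour transporters as ordered bond products with the
K-uniform contour letter (65), the genuine covariant block averaging (64), faithfulness + invertibility (63).  Every constant is uniform in
`K`, the volume and the fibre; the margin is «`a₀, a₁` small against `(C, δ₀, c_μ, d, a, ℓ, N_fibre)`».  HONEST FRAMING: `X` is a hypothesis
family (entries of `e^{±X(u)}` holomorphic in `u` assumed); the contour system is data; multi-level (J-3), O.2, `ExistsUniformAcrossSmall` +
`TermDomination` remain — (D4) instance 0∕1; NOT BetaPertH, NOT continuum, NOT Clay.
-/
import Summits.QuantumFields.BalabanUV.Gaps.D4WalkBlockCovariantBlockAveraging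
import Summits.QuantumFields.BalabanUV.Gaps.D4WalkBlockTransportWindows
import Summits.QuantumFields.BalabanUV.Gaps.D4WalkBlockExpWindow
import Summits.QuantumFields.BalabanUV.Gaps.D4WalkBlockContourWindow

/-!
# `Gaps.D4WalkBlockGaugeField` — the one-scale covariant propagator of a lattice gauge field with (3.37)-windows has a uniform block
# random-walk expansion with derivative letters (cell pub-balaban-gaps, seat g1-p2 gen 7)

HONEST DEPENDENCY (cell pub-balaban, verbatim): continuum YM on T⁴ ⇐ BetaPertH ∧ nine spine estimates (0/9 proved);
BetaPertH ⇐ (D1) ∧ (D4) ∧ CAP+tail.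

* §1 the gauge-field objects: `Ub`/`Ubi` (bond transporters `e^{±X}`), `Wp`/`Wm` (transport defects), `Ug`/`Ugi` (contour transporters),
  `Gc`/`Gci` (their conjugation action on the adjoint fibre), the letters `letterB`, `letterG`.
* §2 their letters from the windows on `X`: `bond_letters`, `deriv_letters`, `contour_letters`, `colSum_listProd_sub_one_le`,
  `contour_letters_col`, `fibre_contour_letters`, `holo_Gc`.
* §3 **`blockWalkExpansion_gaugeField_oneScaleTorus`** — the END.
References: T. Bałaban, Comm. Math. Phys. **99** (1985) 389–434 [B9], (3.8) p.392, (3.37) p.396, (3.50)–(3.64) pp.400–402, Cor. 3.5 p.407;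
CMP **96** (1984) Prop. 2.2 (2.67) p.234; CMP **85** (1982) (2.20).
-/

noncomputable section

namespace Summit.QuantumFields.BalabanUV.Gaps.D4WalkBlockGaugeField

open Metric Set Finset NormedSpace
open scoped Matrix
open Literature.MathematicalPhysics.QuantumFieldTheory.Balaban1983to89
open Literature.MathematicalPhysics.QuantumFieldTheory.Balaban1983to89.B9SectDWalk (DomBy)
open Literature.MathematicalPhysics.QuantumFieldTheory.Balaban1983to89.B9Thm34Ext (toB6)
open Literature.MathematicalPhysics.QuantumFieldTheory.Balaban1983to89.B9Thm37GlueTorus (torusGeom tdist1)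
open Literature.MathematicalPhysics.QuantumFieldTheory.Balaban1983to89.TreeLengthTorus (TPt)
open Literature.MathematicalPhysics.QuantumFieldTheory.Balaban1983to89.B5TorusCover (UT)
open Literature.MathematicalPhysics.QuantumFieldTheory.Balaban1983to89.B11SectG (RowSum)
open Literature.MathematicalPhysics.QuantumFieldTheory.Balaban1983to89.B5Ineq137Torus (Nv)
open Literature.MathematicalPhysics.QuantumFieldTheory.Balaban1983to89.B6Prop22OneScaleTorus (Index)
open Summit.QuantumFields.BalabanUV.Gaps.D4WalkBlock (blockNorm BlockWalkExpansion)
open Summit.QuantumFields.BalabanUV.Gaps.D4WalkBlockFlatLetters (cubeOf)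
open Summit.QuantumFields.BalabanUV.Gaps.D4WalkBlockCovariantShift (covDop covB)
open Summit.QuantumFields.BalabanUV.Gaps.D4WalkBlockTransportAlgebra
  (conjOp rowSumNorm colSumNorm rowMass_defect_le_of_letters rowMass_defect_pair_le)
open Summit.QuantumFields.BalabanUV.Gaps.D4WalkBlockTransportWindows (rowMass_sum_le)
open Summit.QuantumFields.BalabanUV.Gaps.D4WalkBlockShiftTransport (differentiableOn_defect')
open Summit.QuantumFields.BalabanUV.Gaps.D4WalkBlockExpWindow
open Summit.QuantumFields.BalabanUV.Gaps.D4WalkBlockContourWindow (contourLetter_uniform differentiableOn_listProd_entry)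
open Summit.QuantumFields.BalabanUV.Gaps.D4WalkBlockCovariantPropagator (covOp)
open Summit.QuantumFields.BalabanUV.Gaps.D4WalkBlockCovariantBlockAveraging (PU blockWalkExpansion_covariantBlockAveraging_oneScaleTorus)

/-! ## §1. The gauge-field objects -/

section Objects
variable (P : Params) (N : ℕ) {E : Type*} [NormedAddCommGroup E] [NormedSpace ℂ E]
variable (Xf : Fin P.d → E → Site P 0 → Matrix (Fin N) (Fin N) ℂ) (Γ : Site P 0 → List (Fin P.d × Site P 0))

/-- The forward bond transporter `U⁺_μ(u, x) = e^{X_μ(u,x)}` of the bond `(x, x + e_μ)`. -/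
def Ub (ν : Fin P.d) (u : E) (x : Site P 0) : Matrix (Fin N) (Fin N) ℂ := exp (Xf ν u x)

/-- Its inverse `U⁻ = e^{−X}`. -/
def Ubi (ν : Fin P.d) (u : E) (x : Site P 0) : Matrix (Fin N) (Fin N) ℂ := exp (-Xf ν u x)

/-- The forward transport defect `W⁺_μ(x) = R(U⁺) − 1 = conjOp U⁺U⁻ − 1`. [cite: Balaban1985BackgroundPropagators, (3.50)–(3.51) p.400] -/
def Wp (ν : Fin P.d) (u : E) (x : Site P 0) : Matrix (Fin N × Fin N) (Fin N × Fin N) ℂ :=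
  conjOp (Ub P N Xf ν u x) (Ubi P N Xf ν u x) - 1

/-- The backward transport defect `W⁻_μ(x) = conjOp U⁻(x − e_μ)U⁺(x − e_μ) − 1`. -/
def Wm (ν : Fin P.d) (u : E) (x : Site P 0) : Matrix (Fin N × Fin N) (Fin N × Fin N) ℂ :=
  conjOp (Ubi P N Xf ν u (Site.unshift x ν)) (Ub P N Xf ν u (Site.unshift x ν)) - 1

/-- The block-contour transporter `U(Γ_x) = U_{b₁}⋯U_{bₙ}` along the contour `Γ x = [b₁, …, bₙ]` (bond `b = (μ, y)` = `(y, y + e_μ)`).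
[cite: Balaban1985BackgroundPropagators, (3.8) p.392] -/
def Ug (u : E) (x : Site P 0) : Matrix (Fin N) (Fin N) ℂ := ((Γ x).map fun b => Ub P N Xf b.1 u b.2).prod

/-- Its inverse as the reversed product of the inverse bond transporters. -/
def Ugi (u : E) (x : Site P 0) : Matrix (Fin N) (Fin N) ℂ := ((Γ x).map fun b => Ubi P N Xf b.1 u b.2).reverse.prod

/-- The contour transporter on the ADJOINT fibre `Fin N × Fin N`: `R(U(Γ_x)) = conjOp U(Γ_x) U(Γ_x)⁻¹`. -/
def Gc (u : E) (x : Site P 0) : Matrix (Fin N × Fin N) (Fin N × Fin N) ℂ := conjOp (Ug P N Xf Γ u x) (Ugi P N Xf Γ u x)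

/-- Its inverse `R(U(Γ_x)⁻¹) = conjOp U(Γ_x)⁻¹ U(Γ_x)`. -/
def Gci (u : E) (x : Site P 0) : Matrix (Fin N × Fin N) (Fin N × Fin N) ℂ := conjOp (Ugi P N Xf Γ u x) (Ug P N Xf Γ u x)

/-- The letters of this file: `α₀′ = a₀e^{a₀}` (bond), and the fibre contour letter `α_g = 2δ_g + δ_g²`, `δ_g = e^{ℓα₀′} − 1`. -/
def letterB (a₀ : ℝ) : ℝ := a₀ * Real.exp a₀

/-- The fibre contour letter `α_g(ℓ, a₀) = 2δ_g + δ_g²`, `δ_g = e^{ℓ·a₀e^{a₀}} − 1` — free of `K`. -/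
def letterG (ℓ a₀ : ℝ) : ℝ := 2 * (Real.exp (ℓ * letterB a₀) - 1) + (Real.exp (ℓ * letterB a₀) - 1) ^ 2

omit [NormedAddCommGroup E] [NormedSpace ℂ E] in
/-- `U⁺U⁻ = 1`. -/
theorem Ub_mul_Ubi (ν : Fin P.d) (u : E) (x : Site P 0) : Ub P N Xf ν u x * Ubi P N Xf ν u x = 1 := by
  unfold Ub Ubi
  rw [Matrix.exp_neg]; exact Matrix.mul_nonsing_inv _ ((Matrix.isUnit_iff_isUnit_det _).1 (Matrix.isUnit_exp _))

omit [NormedAddCommGroup E] [NormedSpace ℂ E] in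
/-- `U⁻U⁺ = 1`. -/
theorem Ubi_mul_Ub (ν : Fin P.d) (u : E) (x : Site P 0) : Ubi P N Xf ν u x * Ub P N Xf ν u x = 1 :=
  mul_eq_one_comm.1 (Ub_mul_Ubi P N Xf ν u x)

end Objects

/-! ## §2. Letters from the two windows on `X` -/

section Letters
variable (P : Params) (N : ℕ) {E : Type*} [NormedAddCommGroup E] [NormedSpace ℂ E]
variable (Xf : Fin P.d → E → Site P 0 → Matrix (Fin N) (Fin N) ℂ) (Γ : Site P 0 → List (Fin P.d × Site P 0)) {R a₀ a₁ : ℝ}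

omit [NormedSpace ℂ E] in
/-- **Bond letters** from the window `rows ∕ cols of X ≤ ηa₀`: rows and columns of `U^± − 1` at most `η(a₀e^{a₀})`. -/
theorem bond_letters (ha₀ : 0 ≤ a₀)
    (hw0 : ∀ ν, ∀ u ∈ ball (0 : E) R, ∀ x a', rowSumNorm (Xf ν u x) a' ≤ P.eps * a₀ ∧ colSumNorm (Xf ν u x) a' ≤ P.eps * a₀) :
    ∀ ν, ∀ u ∈ ball (0 : E) R, ∀ x a', rowSumNorm (Ub P N Xf ν u x - 1) a' ≤ P.eps * (a₀ * Real.exp a₀) ∧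
      colSumNorm (Ub P N Xf ν u x - 1) a' ≤ P.eps * (a₀ * Real.exp a₀) ∧
      rowSumNorm (Ubi P N Xf ν u x - 1) a' ≤ P.eps * (a₀ * Real.exp a₀) ∧ colSumNorm (Ubi P N Xf ν u x - 1) a' ≤ P.eps * (a₀ * Real.exp a₀) := by
  intro ν u hu x a'
  have hε1 : P.eps ≤ 1 := by
    unfold Params.eps
    exact pow_le_one₀ (inv_nonneg.2 P.cast_L_pos.le) (inv_le_one_of_one_le₀ (by exact_mod_cast P.hL.2.le))
  have hs : 0 ≤ P.eps * a₀ := mul_nonneg P.eps_pos.le ha₀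
  have hb : Real.exp (P.eps * a₀) - 1 ≤ P.eps * (a₀ * Real.exp a₀) := exp_sub_one_le_eps P.eps_pos.le hε1 ha₀
  unfold Ub Ubi
  exact ⟨(rowSumNorm_exp_sub_one_le _ hs (fun b => (hw0 ν u hu x b).1) a').trans hb,
    (colSumNorm_exp_sub_one_le _ hs (fun b => (hw0 ν u hu x b).2) a').trans hb,
    (rowSumNorm_exp_sub_one_le _ hs (fun b => (rowSumNorm_neg (Xf ν u x) b).symm ▸ (hw0 ν u hu x b).1) a').trans hb,
    (colSumNorm_exp_sub_one_le _ hs (fun b => (colSumNorm_neg (Xf ν u x) b).symm ▸ (hw0 ν u hu x b).2) a').trans hb⟩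

omit [NormedSpace ℂ E] in
/-- **Derivative letters** from the two windows: rows and columns of `U⁺_μ(x) − U⁺_μ(x − e_μ)` at most `η²(a₁e^{a₀})`. -/
theorem deriv_letters (ha₀ : 0 ≤ a₀) (ha₁ : 0 ≤ a₁)
    (hw0 : ∀ ν, ∀ u ∈ ball (0 : E) R, ∀ x a', rowSumNorm (Xf ν u x) a' ≤ P.eps * a₀ ∧ colSumNorm (Xf ν u x) a' ≤ P.eps * a₀)
    (hw1 : ∀ ν, ∀ u ∈ ball (0 : E) R, ∀ x a', rowSumNorm (Xf ν u x - Xf ν u (Site.unshift x ν)) a' ≤ P.eps ^ 2 * a₁ ∧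
      colSumNorm (Xf ν u x - Xf ν u (Site.unshift x ν)) a' ≤ P.eps ^ 2 * a₁) :
    ∀ ν, ∀ u ∈ ball (0 : E) R, ∀ x a', rowSumNorm (Ub P N Xf ν u x - Ub P N Xf ν u (Site.unshift x ν)) a' ≤ P.eps ^ 2 * (a₁ * Real.exp a₀) ∧
      colSumNorm (Ub P N Xf ν u x - Ub P N Xf ν u (Site.unshift x ν)) a' ≤ P.eps ^ 2 * (a₁ * Real.exp a₀) := by
  intro ν u hu x a'
  have hε1 : P.eps ≤ 1 := by
    unfold Params.eps
    exact pow_le_one₀ (inv_nonneg.2 P.cast_L_pos.le) (inv_le_one_of_one_le₀ (by exact_mod_cast P.hL.2.le))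
  have hs : 0 ≤ P.eps * a₀ := mul_nonneg P.eps_pos.le ha₀
  have hdl : P.eps ^ 2 * a₁ * Real.exp (P.eps * a₀) ≤ P.eps ^ 2 * (a₁ * Real.exp a₀) := by
    rw [mul_assoc]
    exact mul_le_mul_of_nonneg_left (mul_le_mul_of_nonneg_left (Real.exp_le_exp.2 (by nlinarith [P.eps_pos])) ha₁) (by positivity)
  unfold Ub
  exact ⟨(rowSumNorm_exp_sub_exp_le _ _ hs (by positivity) (fun b => (hw0 ν u hu x b).1) (fun b => (hw0 ν u hu _ b).1)
      (fun b => (hw1 ν u hu x b).1) a').trans hdl,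
    (colSumNorm_exp_sub_exp_le _ _ hs (by positivity) (fun b => (hw0 ν u hu x b).2) (fun b => (hw0 ν u hu _ b).2)
      (fun b => (hw1 ν u hu x b).2) a').trans hdl⟩

omit [NormedSpace ℂ E] in
/-- **Contour letters**, UNIFORM IN `K`: with contour lengths `≤ Nc` and `Nc·η ≤ ℓ`, rows of `U(Γ) − 1` and of `U(Γ)⁻¹ − 1` at most
`e^{ℓ(a₀e^{a₀})} − 1`. -/
theorem contour_letters {Nc : ℕ} {ℓ : ℝ} (ha₀ : 0 ≤ a₀) (hΓ : ∀ x, (Γ x).length ≤ Nc) (hNc : (Nc : ℝ) * P.eps ≤ ℓ)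
    (hw0 : ∀ ν, ∀ u ∈ ball (0 : E) R, ∀ x a', rowSumNorm (Xf ν u x) a' ≤ P.eps * a₀ ∧ colSumNorm (Xf ν u x) a' ≤ P.eps * a₀) :
    ∀ u ∈ ball (0 : E) R, ∀ x c, ∑ b, ‖(Ug P N Xf Γ u x - 1) c b‖ ≤ Real.exp (ℓ * (a₀ * Real.exp a₀)) - 1 ∧
      ∑ b, ‖(Ugi P N Xf Γ u x - 1) c b‖ ≤ Real.exp (ℓ * (a₀ * Real.exp a₀)) - 1 := by
  intro u hu x c
  have hb := bond_letters P N Xf ha₀ hw0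
  refine ⟨contourLetter_uniform P.eps_pos.le (by positivity) hNc _ (by rw [List.length_map]; exact hΓ x) (fun U hU c' => ?_) c,
    contourLetter_uniform P.eps_pos.le (by positivity) hNc _ (by rw [List.length_reverse, List.length_map]; exact hΓ x)
      (fun U hU c' => ?_) c⟩
  · obtain ⟨b, _, rfl⟩ := List.mem_map.1 hU
    exact (hb b.1 u hu b.2 c').1
  · obtain ⟨b, _, rfl⟩ := List.mem_map.1 (List.mem_reverse.1 hU)
    exact (hb b.1 u hu b.2 c').2.2.1

omit [NormedAddCommGroup E] [NormedSpace ℂ E] in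
/-- Column sums of `ΠU_k − 1` from the COLUMN letters of the factors (transpose of `rowSum_listProd_sub_one_le`). -/
theorem colSum_listProd_sub_one_le {δ : ℝ} (hδ : 0 ≤ δ) (l : List (Matrix (Fin N) (Fin N) ℂ))
    (h : ∀ U ∈ l, ∀ b, ∑ c, ‖(U - 1) c b‖ ≤ δ) (b : Fin N) : ∑ c, ‖(l.prod - 1) c b‖ ≤ (1 + δ) ^ l.length - 1 := by
  have e : ∀ c, (l.prod - 1) c b = ((l.map Matrix.transpose).reverse.prod - 1) b c := fun c => by
    rw [← Matrix.transpose_list_prod, Matrix.sub_apply, Matrix.sub_apply, Matrix.transpose_apply, Matrix.one_apply,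
      Matrix.one_apply]
    by_cases hcb : c = b
    · subst hcb; rfl
    · rw [if_neg hcb, if_neg (Ne.symm hcb)]
  simp only [e]
  have h' := D4WalkBlockContourWindow.rowSum_listProd_sub_one_le hδ (l.map Matrix.transpose).reverse (fun U hU c => by
    obtain ⟨V, hV, rfl⟩ := List.mem_map.1 (List.mem_reverse.1 hU)
    have := h V hV c
    calc ∑ b', ‖(Vᵀ - 1) c b'‖ = ∑ b', ‖(V - 1) b' c‖ := Finset.sum_congr rfl fun b' _ => by
            rw [Matrix.sub_apply, Matrix.sub_apply, Matrix.transpose_apply, Matrix.one_apply, Matrix.one_apply]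
            by_cases hh : c = b'
            · subst hh; rfl
            · rw [if_neg hh, if_neg (Ne.symm hh)]
      _ ≤ δ := this) b
  rwa [List.length_reverse, List.length_map] at h'

omit [NormedSpace ℂ E] in
/-- **Contour letters, columns** (uniform in `K`). -/
theorem contour_letters_col {Nc : ℕ} {ℓ : ℝ} (ha₀ : 0 ≤ a₀) (hΓ : ∀ x, (Γ x).length ≤ Nc) (hNc : (Nc : ℝ) * P.eps ≤ ℓ)
    (hw0 : ∀ ν, ∀ u ∈ ball (0 : E) R, ∀ x a', rowSumNorm (Xf ν u x) a' ≤ P.eps * a₀ ∧ colSumNorm (Xf ν u x) a' ≤ P.eps * a₀) :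
    ∀ u ∈ ball (0 : E) R, ∀ x b, ∑ c, ‖(Ug P N Xf Γ u x - 1) c b‖ ≤ Real.exp (ℓ * letterB a₀) - 1 ∧
      ∑ c, ‖(Ugi P N Xf Γ u x - 1) c b‖ ≤ Real.exp (ℓ * letterB a₀) - 1 := by
  intro u hu x b
  have hb := bond_letters P N Xf ha₀ hw0
  have hδ : 0 ≤ P.eps * letterB a₀ := mul_nonneg P.eps_pos.le (by unfold letterB; positivity)
  have hexp : ∀ n : ℕ, n ≤ Nc → (1 + P.eps * letterB a₀) ^ n - 1 ≤ Real.exp (ℓ * letterB a₀) - 1 := fun n hn => by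
    refine (D4WalkBlockContourWindow.one_add_pow_sub_one_le_exp hδ n).trans (sub_le_sub_right (Real.exp_le_exp.2 ?_) _)
    have hB : 0 ≤ letterB a₀ := by unfold letterB; positivity
    have hn' : (n : ℝ) ≤ Nc := by exact_mod_cast hn
    calc (n : ℝ) * (P.eps * letterB a₀) = (n * P.eps) * letterB a₀ := by ring
      _ ≤ (Nc * P.eps) * letterB a₀ := mul_le_mul_of_nonneg_right (mul_le_mul_of_nonneg_right hn' P.eps_pos.le) hB
      _ ≤ ℓ * letterB a₀ := mul_le_mul_of_nonneg_right hNc hB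
  refine ⟨(colSum_listProd_sub_one_le N hδ _ (fun U hU b' => ?_) b).trans ?_,
    (colSum_listProd_sub_one_le N hδ _ (fun U hU b' => ?_) b).trans ?_⟩
  · obtain ⟨e, _, rfl⟩ := List.mem_map.1 hU
    exact (hb e.1 u hu e.2 b').2.1
  · rw [List.length_map]; exact hexp _ (hΓ x)
  · obtain ⟨e, _, rfl⟩ := List.mem_map.1 (List.mem_reverse.1 hU)
    exact (hb e.1 u hu e.2 b').2.2.2
  · rw [List.length_reverse, List.length_map]; exact hexp _ (hΓ x)

omit [NormedSpace ℂ E] in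
/-- **Fibre contour letters**: rows of `R(U(Γ)) − 1` and of `R(U(Γ)⁻¹) − 1` at most `α_g = 2δ_g + δ_g²` (60a's bond window on the
adjoint fibre). -/
theorem fibre_contour_letters {Nc : ℕ} {ℓ : ℝ} (ha₀ : 0 ≤ a₀) (hΓ : ∀ x, (Γ x).length ≤ Nc) (hNc : (Nc : ℝ) * P.eps ≤ ℓ)
    (hℓ : 0 ≤ ℓ)
    (hw0 : ∀ ν, ∀ u ∈ ball (0 : E) R, ∀ x a', rowSumNorm (Xf ν u x) a' ≤ P.eps * a₀ ∧ colSumNorm (Xf ν u x) a' ≤ P.eps * a₀) :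
    ∀ u ∈ ball (0 : E) R, ∀ x p, ∑ q, ‖(Gc P N Xf Γ u x - 1) p q‖ ≤ letterG ℓ a₀ ∧ ∑ q, ‖(Gci P N Xf Γ u x - 1) p q‖ ≤ letterG ℓ a₀ := by
  intro u hu x p
  obtain ⟨p1, p2⟩ := p
  have hr := contour_letters P N Xf Γ ha₀ hΓ hNc hw0 u hu x
  have hc := contour_letters_col P N Xf Γ ha₀ hΓ hNc hw0 u hu x
  have hδ : 0 ≤ Real.exp (ℓ * letterB a₀) - 1 := by
    have : 0 ≤ ℓ * letterB a₀ := mul_nonneg hℓ (by unfold letterB; positivity)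
    linarith [Real.add_one_le_exp (ℓ * letterB a₀)]
  have e : ∀ δ : ℝ, δ * (1 + δ) + δ = 2 * δ + δ ^ 2 := fun δ => by ring
  refine ⟨?_, ?_⟩
  · unfold Gc
    calc _ ≤ _ := rowMass_defect_le_of_letters _ _ hδ (fun a' => (hr a').1) (fun b => (hc b).2) p1 p2
      _ = letterG ℓ a₀ := by rw [letterG, e]
  · unfold Gci
    calc _ ≤ _ := rowMass_defect_le_of_letters _ _ hδ (fun a' => (hr a').2) (fun b => (hc b).1) p1 p2
      _ = letterG ℓ a₀ := by rw [letterG, e]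

/-- Entries of the contour transporters and of their fibre conjugations are holomorphic when those of `e^{±X}` are. -/
theorem holo_Gc {R : ℝ} (hUp : ∀ ν x a' c, DifferentiableOn ℂ (fun u => exp (Xf ν u x) a' c) (ball (0 : E) R))
    (hUpi : ∀ ν x a' c, DifferentiableOn ℂ (fun u => exp (-Xf ν u x) a' c) (ball (0 : E) R)) :
    (∀ x p q, DifferentiableOn ℂ (fun u => Gc P N Xf Γ u x p q) (ball (0 : E) R)) ∧
      ∀ x p q, DifferentiableOn ℂ (fun u => Gci P N Xf Γ u x p q) (ball (0 : E) R) := by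
  have hUg : ∀ x a' c, DifferentiableOn ℂ (fun u => Ug P N Xf Γ u x a' c) (ball (0 : E) R) := fun x a' c => by
    have h := differentiableOn_listProd_entry (s := ball (0 : E) R) ((Γ x).map fun b => fun u => Ub P N Xf b.1 u b.2)
      (fun U hU c' b' => by obtain ⟨b, _, rfl⟩ := List.mem_map.1 hU; exact hUp b.1 b.2 c' b') a' c
    simp only [List.map_map] at h
    exact h
  have hUgi : ∀ x a' c, DifferentiableOn ℂ (fun u => Ugi P N Xf Γ u x a' c) (ball (0 : E) R) := fun x a' c => by
    have h := differentiableOn_listProd_entry (s := ball (0 : E) R) ((Γ x).reverse.map fun b => fun u => Ubi P N Xf b.1 u b.2)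
      (fun U hU c' b' => by obtain ⟨b, _, rfl⟩ := List.mem_map.1 hU; exact hUpi b.1 b.2 c' b') a' c
    simp only [List.map_map] at h
    have e : ∀ u, Ugi P N Xf Γ u x = ((Γ x).reverse.map ((fun U => U u) ∘ fun b u => Ubi P N Xf b.1 u b.2)).prod := fun u => by
      rw [Ugi, List.map_reverse]; rfl
    simp only [e]; exact h
  refine ⟨fun x p q => ?_, fun x p q => ?_⟩
  · simp only [Gc, conjOp, Matrix.of_apply]; exact (hUg x _ _).mul (hUgi x _ _)
  · simp only [Gci, conjOp, Matrix.of_apply]; exact (hUgi x _ _).mul (hUg x _ _)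

end Letters

/-! ## §3. The END: the covariant one-scale propagator of a gauge field with (3.37)-windows -/

section Step
variable {d L : ℕ} {a msq : ℝ}
variable {dd N' : ℕ} {E : Type*} [NormedAddCommGroup E] [NormedSpace ℂ E]

/-- **[B9] COR. 3.5 ON THE ONE-SCALE TORUS FAMILY FOR A LATTICE GAUGE FIELD WITH (3.37)-WINDOWS.**  There are `δ₀, C > 0` (B6's) such
that for every member `i`, every `N`, every family of bond logarithms `X_μ(u, x) ∈ Matrix (Fin N) (Fin N) ℂ` whose exponentials `e^{±X}`
have holomorphic entries on a ball and which satisfies there the two (3.37)-SHAPED WINDOWS — rows ∕ columns of `X_μ(u, x)` at most `ηa₀`,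
of `X_μ(u, x) − X_μ(u, x − e_μ)` at most `η²a₁` —, every in-cube contour system `Γ` (lengths `≤ Nc`, `Nc·η ≤ ℓ`), every cube row sum
`(μ, c_μ)`, rates `0 ≤ μ`, `2μ ≤ ε`, `2μ ≤ ½δ₀ − ε − μ`, and the MARGIN below (letters `α₀′ = a₀e^{a₀}`, `α₁′ = a₁e^{a₀}`, `α = 2α₀′ + α₀′²`,
`α′ = d(2α₁′ + 4α₀′²)`, `δ_g = e^{ℓα₀′} − 1`, `α_g = 2δ_g + δ_g²` (adjoint fibre), `α_av = a_K(2α_g + α_g²)`): the one-scale covariant propagator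
`(Δ_U(u) + m² + a_KP_K(U)(u))⁻¹` (transport defects of `U = e^{X}`, genuine covariant block averaging along `Γ`) is a block walk expansion
at `(ε − 2μ, ½δ₀ − ε − 3μ, ·, ½δ₀ − 2μ)` with the relative derivative letters `covB δ₀` and dominating distances — NO constant depends on
`K`, the volume or the fibre. [cite: Balaban1985BackgroundPropagators, Cor. 3.5 p.407, (3.8) p.392, (3.37) p.396, (3.50)–(3.64) pp.400–402; Balaban1984PropagatorsII, Prop. 2.2 (2.67) p.234] -/
theorem blockWalkExpansion_gaugeField_oneScaleTorus (hd : 1 ≤ d) (hL : Odd L ∧ 1 < L) (ha : 0 < a) (hmsq : 0 ≤ msq) :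
    ∃ δ₀ C : ℝ, 0 < δ₀ ∧ 0 < C ∧ ∀ (i : Index d L) (N : ℕ) (c₀ : B13.Consts) (X : Finset (UT (Nv i.P i.P.K))) (R : ℝ)
      (Xf : Fin i.P.d → E → Site i.P 0 → Matrix (Fin N) (Fin N) ℂ) (Γ : Site i.P 0 → List (Fin i.P.d × Site i.P 0))
      (Nc : ℕ) (ℓ a₀ a₁ ε μ cμ : ℝ),
      (∀ ν x a' c, DifferentiableOn ℂ (fun u => exp (Xf ν u x) a' c) (ball (0 : E) R)) →
      (∀ ν x a' c, DifferentiableOn ℂ (fun u => exp (-Xf ν u x) a' c) (ball (0 : E) R)) →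
      0 ≤ a₀ → 0 ≤ a₁ → (∀ x, (Γ x).length ≤ Nc) → (Nc : ℝ) * i.P.eps ≤ ℓ → 0 ≤ ℓ →
      (∀ ν, ∀ u ∈ ball (0 : E) R, ∀ x a', rowSumNorm (Xf ν u x) a' ≤ i.P.eps * a₀ ∧ colSumNorm (Xf ν u x) a' ≤ i.P.eps * a₀) →
      (∀ ν, ∀ u ∈ ball (0 : E) R, ∀ x a', rowSumNorm (Xf ν u x - Xf ν u (Site.unshift x ν)) a' ≤ i.P.eps ^ 2 * a₁ ∧
        colSumNorm (Xf ν u x - Xf ν u (Site.unshift x ν)) a' ≤ i.P.eps ^ 2 * a₁) →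
      0 ≤ μ → 2 * μ ≤ ε → 2 * μ ≤ δ₀ / 2 - ε - μ → 0 ≤ cμ →
      RowSum (toB6 (torusGeom (Nv i.P i.P.K) 0 0 0) 0 True) μ cμ →
      cμ * (cμ * 1 * (1 * (((i.P.d : ℝ) * (2 * (a₁ * Real.exp a₀) + 4 * letterB a₀ ^ 2) +
        B1RG242Torus.α i.P a i.P.K * (2 * letterG ℓ a₀ + letterG ℓ a₀ ^ 2) +
        ∑ ι, (2 * letterB a₀ + letterB a₀ ^ 2) * covB i.P δ₀ ι) * C)) * cμ) * cμ < 1 →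
      ∃ (W : Type) (T : W → (TPt dd N' → ℂ) → E → Matrix (Site i.P 0 × (Fin N × Fin N)) (Site i.P 0 × (Fin N × Fin N)) ℂ)
        (SX' : Set W) (A' : W → ℝ) (D' : W → UT (Nv i.P i.P.K) → UT (Nv i.P i.P.K) → ℝ),
        BlockWalkExpansion c₀ (fun q : Site i.P 0 × (Fin N × Fin N) => cubeOf i.P q.1) (fun q => cubeOf i.P q.1)
          (fun (_ : TPt dd N' → ℂ) u =>
            (covOp i.P (Fin N × Fin N) (Wp i.P N Xf) (Wm i.P N Xf) (PU i.P (Fin N × Fin N) (Gc i.P N Xf Γ) (Gci i.P N Xf Γ))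
              a msq u)⁻¹) X R
          (ε - 2 * μ) (δ₀ / 2 - ε - μ - 2 * μ)
          (cμ * C * (1 * (1 - cμ * (cμ * 1 * (1 * (((i.P.d : ℝ) * (2 * (a₁ * Real.exp a₀) + 4 * letterB a₀ ^ 2) +
            B1RG242Torus.α i.P a i.P.K * (2 * letterG ℓ a₀ + letterG ℓ a₀ ^ 2) +
            ∑ ι, (2 * letterB a₀ + letterB a₀ ^ 2) * covB i.P δ₀ ι) * C)) * cμ) * cμ)⁻¹) * cμ)
          T SX' A' D' (δ₀ / 2 - 2 * μ) ∧
        (∀ (ι : Fin i.P.d ⊕ Fin i.P.d) ω (σ : TPt dd N' → ℂ), (∀ j, ‖σ j‖ ≤ Real.exp c₀.κ₁) → ∀ u ∈ ball (0 : E) R, ∀ Y Y',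
          blockNorm (fun q : Site i.P 0 × (Fin N × Fin N) => cubeOf i.P q.1) (fun q => cubeOf i.P q.1)
              (covDop i.P (Fin N × Fin N) ι * T ω σ u) Y Y' ≤
            covB i.P δ₀ ι * (A' ω * Real.exp (-((δ₀ / 2 - 2 * μ) * D' ω Y Y')))) ∧
        ∀ ω, DomBy (toB6 (torusGeom (Nv i.P i.P.K) 0 0 0) 0 True) (D' ω) := by
  obtain ⟨δ₀, C, hδ₀, hC, h⟩ :=
    blockWalkExpansion_covariantBlockAveraging_oneScaleTorus (dd := dd) (N' := N') (E := E) (a := a) (msq := msq) hd hL ha hmsq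
  refine ⟨δ₀, C, hδ₀, hC, fun i N c₀ X R Xf Γ Nc ℓ a₀ a₁ ε μ cμ hUp hUpi ha₀ ha₁ hΓ hNc hℓ hw0 hw1 hμ hμε hμκ hcμ hrow hq => ?_⟩
  have hε : 0 < i.P.eps := i.P.eps_pos
  have hε1 : i.P.eps ≤ 1 := by
    unfold Params.eps
    exact pow_le_one₀ (inv_nonneg.2 i.P.cast_L_pos.le) (inv_le_one_of_one_le₀ (by exact_mod_cast i.P.hL.2.le))
  have hB0 : 0 ≤ letterB a₀ := by unfold letterB; positivity
  have hbond : ∀ ν, ∀ u ∈ ball (0 : E) R, ∀ x a', rowSumNorm (Ub i.P N Xf ν u x - 1) a' ≤ i.P.eps * letterB a₀ ∧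
      colSumNorm (Ub i.P N Xf ν u x - 1) a' ≤ i.P.eps * letterB a₀ ∧ rowSumNorm (Ubi i.P N Xf ν u x - 1) a' ≤ i.P.eps * letterB a₀ ∧
      colSumNorm (Ubi i.P N Xf ν u x - 1) a' ≤ i.P.eps * letterB a₀ := bond_letters i.P N Xf ha₀ hw0
  have hder := deriv_letters i.P N Xf ha₀ ha₁ hw0 hw1
  have hinv : ∀ ν u x, Ub i.P N Xf ν u x * Ubi i.P N Xf ν u x = 1 := Ub_mul_Ubi i.P N Xf
  have hinv' : ∀ ν u x, Ubi i.P N Xf ν u x * Ub i.P N Xf ν u x = 1 := Ubi_mul_Ub i.P N Xf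
  obtain ⟨hGch, hGcih⟩ := holo_Gc i.P N Xf Γ hUp hUpi
  have hG := fibre_contour_letters i.P N Xf Γ ha₀ hΓ hNc hℓ hw0
  have hGpos : 0 ≤ letterG ℓ a₀ := by
    have : 0 ≤ Real.exp (ℓ * letterB a₀) - 1 := by
      have : 0 ≤ ℓ * letterB a₀ := mul_nonneg hℓ hB0
      linarith [Real.add_one_le_exp (ℓ * letterB a₀)]
    unfold letterG; positivity
  refine h i (Fin N × Fin N) c₀ X R (Wp i.P N Xf) (Wm i.P N Xf) (Gc i.P N Xf Γ) (Gci i.P N Xf Γ) (2 * letterB a₀ + letterB a₀ ^ 2)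
    ((i.P.d : ℝ) * (2 * (a₁ * Real.exp a₀) + 4 * letterB a₀ ^ 2)) (letterG ℓ a₀) ε μ cμ
    (fun ν x p q => differentiableOn_defect' (fun a' c => hUp ν x a' c) (fun a' c => hUpi ν x a' c) p q)
    (fun ν x p q => differentiableOn_defect' (fun a' c => hUpi ν _ a' c) (fun a' c => hUp ν _ a' c) p q)
    hGch hGcih (by positivity) (by positivity) hGpos (fun ν u hu x p => ?_) (fun ν u hu x p => ?_) (fun u hu x p => ?_)
    (fun u hu x c => (hG u hu x c).1) (fun u hu x c => (hG u hu x c).2) hμ hμε hμκ hcμ hrow hq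
  · -- bond window, forward defect
    obtain ⟨a', b⟩ := p
    have hδ : 0 ≤ i.P.eps * letterB a₀ := by positivity
    calc ∑ q, ‖(Wp i.P N Xf ν u x) (a', b) q‖
        ≤ i.P.eps * letterB a₀ * (1 + i.P.eps * letterB a₀) + i.P.eps * letterB a₀ :=
          rowMass_defect_le_of_letters _ _ hδ (fun a => (hbond ν u hu x a).1) (fun b => (hbond ν u hu x b).2.2.2) a' b
      _ ≤ i.P.eps * (2 * letterB a₀ + letterB a₀ ^ 2) := by
          nlinarith [mul_nonneg hε.le hB0, mul_le_of_le_one_left (mul_nonneg hε.le hB0) hε1]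
  · -- bond window, backward defect
    obtain ⟨a', b⟩ := p
    have hδ : 0 ≤ i.P.eps * letterB a₀ := by positivity
    calc ∑ q, ‖(Wm i.P N Xf ν u x) (a', b) q‖
        ≤ i.P.eps * letterB a₀ * (1 + i.P.eps * letterB a₀) + i.P.eps * letterB a₀ :=
          rowMass_defect_le_of_letters _ _ hδ (fun a => (hbond ν u hu _ a).2.2.1) (fun b => (hbond ν u hu _ b).2.1) a' b
      _ ≤ i.P.eps * (2 * letterB a₀ + letterB a₀ ^ 2) := by
          nlinarith [mul_nonneg hε.le hB0, mul_le_of_le_one_left (mul_nonneg hε.le hB0) hε1]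
  · -- divergence window
    obtain ⟨a', b⟩ := p
    have hδ : 0 ≤ i.P.eps * letterB a₀ := by positivity
    have hpair : ∀ ν, ∑ q, ‖((Wp i.P N Xf ν u x) + (Wm i.P N Xf ν u x)) (a', b) q‖ ≤
        2 * (i.P.eps ^ 2 * (a₁ * Real.exp a₀)) + 4 * (i.P.eps * letterB a₀) ^ 2 := fun ν =>
      rowMass_defect_pair_le _ _ _ _ (hinv ν u x) (hinv' ν u _) hδ (fun a => (hbond ν u hu x a).1)
        (fun b => (hbond ν u hu x b).2.1) (fun b => (hbond ν u hu x b).2.2.2) (fun a => (hbond ν u hu _ a).1)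
        (fun b => (hbond ν u hu _ b).2.1) (fun a => (hbond ν u hu _ a).2.2.1) (fun a => (hder ν u hu x a).1)
        (fun b => (hder ν u hu x b).2) a' b
    calc ∑ q, ‖(∑ ν, ((Wp i.P N Xf ν u x) + (Wm i.P N Xf ν u x))) (a', b) q‖
        ≤ ∑ ν, ∑ q, ‖((Wp i.P N Xf ν u x) + (Wm i.P N Xf ν u x)) (a', b) q‖ := rowMass_sum_le _ _ _
      _ ≤ ∑ _ν : Fin i.P.d, (2 * (i.P.eps ^ 2 * (a₁ * Real.exp a₀)) + 4 * (i.P.eps * letterB a₀) ^ 2) :=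
          Finset.sum_le_sum fun ν _ => hpair ν
      _ = i.P.eps ^ 2 * ((i.P.d : ℝ) * (2 * (a₁ * Real.exp a₀) + 4 * letterB a₀ ^ 2)) := by
          rw [Finset.sum_const, Finset.card_univ, Fintype.card_fin, nsmul_eq_mul]; ring

end Step

end Summit.QuantumFields.BalabanUV.Gaps.D4WalkBlockGaugeField

end
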